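import Summits.ResolutionOfSingularities.ResolutionOfSingularities.Theorems.PurelyInseparableDim4ResConeEventuallyGoodPrime
import Summits.ResolutionOfSingularities.ResolutionOfSingularities.Theorems.PurelyInseparableDim4ResConeTiltedTail
import HarnessLib
import HarnessLib.Audit.Tags

/-!
# Purely inseparable four-folds — THE SLICE-C(p, p−1) SOCKET: the two-letter game is the ONLY input, for every prime `p`; and the
# `(5,4)` instance re-derives TAIL-D's shade-4 statement by the general-`p` route (K2(p) lane, SLICE C; file-holder res-dim4-p-5 g5)

[OURS · counted 0 · cell `res-dim4-pi` · K2(p) lane, slice C (general-`p` programme, holder GO 2026-08-29 08:32:59Z) · seat p-5 g5.]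
Nothing here proves K2(p) for any `p`, `NoIsolatedTrap p p` or resolution of singularities in dimension ≥ 4 / characteristic `p` — NOT
proved.  AI kernel work, weaker than expert review.

* **`no_primeShade_tail_of_noPairTail (p) (hpair)`** — for every prime `p`: IF no witnessed isolated above-floor `Step0 p` chain with
  `x^{r₀} ∣ F₀` has constant shade `p − 1`, `e_G ≡ 2`, chart letters in a fixed pair `{a, a′}` and the other two letters never boundary
  (the TWO-LETTER GAME, binder `hpair`), THEN no such chain has constant shade `p − 1` and `e_G ≡ 2` from any `k₀` at all
  (res-dim4-p-5 g5 `pair_representation_prime`: every such tail has an honest pair-confined partner);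
* **`no_shadeFour_binaryCone_tail_five'`** — the `p = 5` instance, with `hpair` DISCHARGED by res-dim4-p-5 g4's `no_pair_tail_four_five`
  (p703039): a THIRD kernel route to «no constant-shade-4 `e_G = 2` tail at p = 5» (first: the Φ-line, res-dim4-p-7 g5 p707872; second:
  light pair p707288 + honest D∞ transport p708948), through the general-`p` goodness theorem instead of the W₄ dichotomy.
[cite: CossartJannsenSaito2020, Thm. 3.10(4), Thm. 3.14, Thm. 9.3, Lemma 13.2] [cite: Hauser2010, §§F–G (chart expressions of a point blowup; cleaning)]
bears_on: LADDER-RESOLUTION:D157-DOOR2 (res-dim4-pi · K2(p) = `RidgeBudget.NoAboveFloorTrap p p` · slice C(p, p−1) socket).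
Supports stmt-ResolutionOfSingularities-16155 (helper).
-/

set_option linter.dupNamespace false -- mandated namespace of this single-conjunct summit

noncomputable section

namespace Summit.ResolutionOfSingularities.ResolutionOfSingularities.Theorems.PIDim4

namespace ResCone

open MvPolynomial Finset
open Literature.AlgebraicGeometry.Resolution
open Literature.AlgebraicGeometry.Resolution.CentreBlowup
open Literature.AlgebraicGeometry.Resolution.Hauser2010
open Literature.AlgebraicGeometry.Resolution.HauserPerlega2019

variable {K : Type} [Field K] [DecidableEq K]

/-- **THE SLICE-C(p, p−1) SOCKET, every prime `p`**: the two-letter game (no pair-confined passive-free constant-shade-`(p−1)` `e_G = 2`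
tail, binder `hpair`) implies that NO witnessed isolated above-floor `Step0 p` chain with `x^{r₀} ∣ F₀` has constant shade `p − 1` and
`e_G ≡ 2` from some `k₀` on. [OURS · conditional on `hpair`] [cite: CossartJannsenSaito2020, Thm. 3.10(4), Thm. 3.14, Thm. 9.3] -/
theorem no_primeShade_tail_of_noPairTail (p : ℕ) [Fact p.Prime] [CharP K p]
    (hpair : ∀ (c : ℕ → State K) (j : ℕ → Fin 4) (b : ℕ → Fin 4 → K) (a a' : Fin 4) (d : ℕ), d + 1 = p → a ≠ a' →
      (∀ k, IsIsolated p (c k).F ∧ Step0 p (c k) (c (k + 1))) → FreeTail.IsWitnessedChain p c j b →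
      (∀ e ∈ (c 0).F.support, (c 0).r ≤ e) → (∀ k, ordZero (c k).F ≠ p) →
      (∀ k, 0 ≤ k → (c k).shade = (d : ℕ∞)) → (∀ k, 0 ≤ k → Module.finrank K (resVertex (c k)) = 2) →
      (∀ k, 0 ≤ k → (j k = a ∨ j k = a')) → (∀ k, 0 ≤ k → ∀ i, i ≠ a → i ≠ a' → (c k).r i = 0) → False)
    {c : ℕ → State K} {j : ℕ → Fin 4} {b : ℕ → Fin 4 → K}
    (hc : ∀ k, IsIsolated p (c k).F ∧ Step0 p (c k) (c (k + 1))) (hw : FreeTail.IsWitnessedChain p c j b)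
    (hr0 : ∀ e ∈ (c 0).F.support, (c 0).r ≤ e) (hfloor : ∀ k, ordZero (c k).F ≠ p) {k₀ d : ℕ} (hd : d + 1 = p)
    (hshade : ∀ k, k₀ ≤ k → (c k).shade = (d : ℕ∞)) (he : ∀ k, k₀ ≤ k → Module.finrank K (resVertex (c k)) = 2) : False := by
  obtain ⟨-, a, a', c', j', b', -, haa', -, -, hc', hw', hr0', hfloor', hshade', he', hletters, hpass⟩ :=
    pair_representation_prime p hc hw hr0 hfloor hd hshade he (le_refl k₀)
  exact hpair c' j' b' a a' d hd haa' hc' hw' hr0' hfloor' hshade' he' hletters hpass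

/-- **THE `p = 5` INSTANCE, UNCONDITIONAL**: no witnessed isolated above-floor `Step0 5` chain with `x^{r₀} ∣ F₀` has constant shade `4`
and `e_G ≡ 2` from some `k₀` on — by the general-`p` goodness route, the two-letter game at `(5,4)` being res-dim4-p-5 g4's
`no_pair_tail_four_five`.  (Third kernel route to this statement; cf. res-dim4-p-7 g5's `no_shadeFour_binaryCone_tail_five`.) [OURS]
[cite: CossartJannsenSaito2020, Thm. 3.10(4), Thm. 3.14, Thm. 9.3, Lemma 13.2, Lemma 13.4, Thm. 13.7] -/
theorem no_shadeFour_binaryCone_tail_five' [CharP K 5] {c : ℕ → State K} {j : ℕ → Fin 4} {b : ℕ → Fin 4 → K}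
    (hc : ∀ k, IsIsolated 5 (c k).F ∧ Step0 5 (c k) (c (k + 1))) (hw : FreeTail.IsWitnessedChain 5 c j b)
    (hr0 : ∀ e ∈ (c 0).F.support, (c 0).r ≤ e) (hfloor : ∀ k, ordZero (c k).F ≠ (5 : ℕ)) {k₀ : ℕ}
    (hshade : ∀ k, k₀ ≤ k → (c k).shade = ((4 : ℕ) : ℕ∞))
    (he : ∀ k, k₀ ≤ k → Module.finrank K (resVertex (c k)) = 2) : False := by
  haveI : Fact (Nat.Prime 5) := ⟨by norm_num⟩
  refine no_primeShade_tail_of_noPairTail 5 (fun c j b a a' d hd haa' hc hw hr0 hfloor hshade he hletters hpass => ?_)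
    hc hw hr0 hfloor (d := 4) rfl hshade he
  have hd4 : d = 4 := by omega
  subst hd4
  exact no_pair_tail_four_five hc hw hr0 (fun k => by exact_mod_cast hfloor k) hshade he haa' hletters hpass

end ResCone

end Summit.ResolutionOfSingularities.ResolutionOfSingularities.Theorems.PIDim4

end
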